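import Summits.QuantumFields.YangMills.Theorems.TwistExponentGapHodgeData
import Summits.QuantumFields.YangMills.Theorems.TwistExponentGapGaugeMinimalFirstOrder
import HarnessLib

/-!
# The local Morse–Bott inequality at a twisted-flat configuration, for GAUGE-MINIMAL configurations (core of step (W3) of ⟨stmt-QuantumFields-24054⟩)
# (route-independent helper toward the crux `TwistExponentGap.RigidTwistCeiling`; free hands of width seat ym-line-sfw-p2-w3)

`quadraticGrowth_of_gaugeMinimal`: under the crux's hypotheses (compact `G`, lattice representation `r`, central `z` with pair-rigidity)
and at a `z`-twisted-flat `U₀` there are `ε₁ > 0`, `c > 0` such that for every `V` that is link-wise `ε₁`-close to `U₀`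
(`‖r(V e) − r(U₀ e)‖_F ≤ ε₁`) and GAUGE-MINIMAL (`Σ_e ‖r(V e) − r(U₀ e)‖² ≤ Σ_e ‖r(V e) − r((h·U₀) e)‖²` for all lattice gauge `h`):
`c·‖r(V e) − r(U₀ e)‖² ≤ S_z(V)` for every link `e`.  Proof = the chain of this seat's files: exponential chart per link
(`exists_exp_chart_range`), twisted plaquette cost `≥ ½‖(d¹X)_p‖² − 190|X|³` (`abs_twistedCost_sub_half_norm_sq_le`), the complex
and its Hodge data in matrix form (`exists_hodge_data`: `d₁∘d₀ = 0`, h¹ = 0, Hodge constant `K`), and the first-order condition of gauge-minimality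
(`sum_inner_eq_zero_of_isMinOn_exp_mul_exp`): `‖d₀-part‖ ≤ 2|X|²`, `‖rest‖ ≤ K‖d₁X‖`, `‖d₁X‖² ≤ 2S_z + 380·#P·|X|³`, absorb.
With `localMorseBott_of_gaugeMinimal` (p776464) and `twistedAction_gaugeTransform` this gives (MB_loc), hence the crux via ✓p775343.
HONEST FRAMING: finite-dimensional analysis on a fixed lattice; nothing here bears on a summit statement or on the Yang–Mills mass gap.
-/

set_option autoImplicit false

noncomputable section

open scoped Matrix Matrix.Norms.Frobenius RealInnerProductSpace BigOperators
open NormedSpace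
open Literature.MathematicalPhysics.QuantumFieldTheory
open Literature.MathematicalPhysics.QuantumLattice

namespace Summit.QuantumFields.YangMills.Theorems.TwistExponentGap

variable {G : Type*} [Group G] [TopologicalSpace G] [CompactSpace G]

/-- Real-arithmetic absorption step. -/
theorem absorb_aux {Nx2 T B S K Nx P : ℝ} (hK : 0 < K) (hNx2 : 0 ≤ Nx2) (hP : 0 ≤ P)
    (hNx : 0 ≤ Nx) (hNxsq : Nx ^ 2 = Nx2) (hNx4 : Nx ≤ 1 / 4) (hNxs : Nx ≤ 1 / (1520 * (P * K ^ 2 + 1)))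
    (h1 : Nx2 = T ^ 2 + B ^ 2) (hT0 : 0 ≤ T) (hT : T ≤ 2 * Nx2)
    (hB : B ^ 2 ≤ K ^ 2 * (2 * S + 380 * P * Nx * Nx2)) : Nx2 ≤ 4 * K ^ 2 * S := by
  have hT2 : T ^ 2 ≤ 4 * Nx2 * Nx2 := by nlinarith
  have hNx2le : Nx2 ≤ 1 / 16 := by nlinarith
  have hA : T ^ 2 ≤ Nx2 / 4 := by nlinarith
  have hPK : 0 ≤ P * K ^ 2 := by positivity
  have hcoef : 380 * P * K ^ 2 * Nx ≤ 1 / 4 := by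
    have hden : 0 < 1520 * (P * K ^ 2 + 1) := by positivity
    have h2 : 380 * P * K ^ 2 * Nx ≤ 380 * P * K ^ 2 * (1 / (1520 * (P * K ^ 2 + 1))) :=
      mul_le_mul_of_nonneg_left hNxs (by positivity)
    refine h2.trans ?_
    rw [mul_one_div, div_le_iff₀ hden]
    nlinarith
  have hC : K ^ 2 * (380 * P * Nx * Nx2) ≤ Nx2 / 4 := by
    have : K ^ 2 * (380 * P * Nx * Nx2) = (380 * P * K ^ 2 * Nx) * Nx2 := by ring
    rw [this]
    nlinarith
  nlinarith

/-- **Quadratic growth of the twisted action off a twisted-flat configuration, at gauge-minimal configurations.** -/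
theorem quadraticGrowth_of_gaugeMinimal (r : LatticeRep G) {d S : ℕ} [NeZero S] (U₀ : GaugeConfig d S G)
    (q : {p : Fin d × Fin d // p.1 < p.2}) (z : G) (hz : z ∈ Subgroup.center G)
    (hrig : ∀ x y : G, x * y * x⁻¹ * y⁻¹ = z → Set.Finite {k : G | k * x = x * k ∧ k * y = y * k})
    (htf : ∀ p : Plaquette d S, (if p.2 = q ∧ p.1 q.1.1 = 0 ∧ p.1 q.1.2 = 0 then z else 1) *
      plaquetteHolonomy U₀ p.1 p.2.1.1 p.2.1.2 = 1) :
    ∃ ε₁ c : ℝ, 0 < ε₁ ∧ 0 < c ∧ ∀ V : GaugeConfig d S G,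
      (∀ e, ‖r.ρ (V e) - r.ρ (U₀ e)‖ ≤ ε₁) →
      (∀ h : Site d S → G, ∑ e, ‖r.ρ (V e) - r.ρ (U₀ e)‖ ^ 2 ≤ ∑ e, ‖r.ρ (V e) - r.ρ (gaugeTransform h U₀ e)‖ ^ 2) →
      ∀ e, c * ‖r.ρ (V e) - r.ρ (U₀ e)‖ ^ 2 ≤
        ∑ p : Plaquette d S, ((r.N : ℝ) - (r.ρ ((if p.2 = q ∧ p.1 q.1.1 = 0 ∧ p.1 q.1.2 = 0 then z else 1) *
          plaquetteHolonomy V p.1 p.2.1.1 p.2.1.2)).trace.re) := by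
  classical
  letI : InnerProductSpace ℝ (Matrix (Fin r.N) (Fin r.N) ℂ) := frobeniusInnerProductSpace
  have hinv1 : ∀ g : G, r.ρ g⁻¹ * r.ρ g = 1 := fun g => by rw [← map_mul, inv_mul_cancel, map_one]
  have hinv2 : ∀ g : G, r.ρ g * r.ρ g⁻¹ = 1 := fun g => by rw [← map_mul, mul_inv_cancel, map_one]
  -- the Hodge data of the complex (matrix form)
  obtain ⟨K, hK, hdata⟩ := exists_hodge_data r U₀ q z hz hrig htf
  -- the chart radius
  obtain ⟨r₀, hr₀, hchart⟩ := Literature.Analysis.Calculus.exists_exp_chart_range r.ρ r.continuous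
  -- constants
  set nE : ℝ := (Fintype.card (Edge d S) : ℝ) with hnE
  set nP : ℝ := (Fintype.card (Plaquette d S) : ℝ) with hnP
  have hnE0 : 0 ≤ nE := Nat.cast_nonneg _
  have hnP0 : 0 ≤ nP := Nat.cast_nonneg _
  clear_value nE nP
  set ε₁ : ℝ := min (r₀ / 2) (1 / (8 * (nE + 1) * (1520 * (nP * K ^ 2 + 1)))) with hε₁
  have hden : 0 < 8 * (nE + 1) * (1520 * (nP * K ^ 2 + 1)) :=
    mul_pos (mul_pos (by norm_num) (by linarith)) (mul_pos (by norm_num) (by nlinarith [sq_nonneg K]))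
  have hε₁pos : 0 < ε₁ := lt_min (by linarith) (one_div_pos.2 hden)
  have hε₁r : ε₁ < r₀ := (min_le_left _ _).trans_lt (by linarith)
  have hε₁b : ε₁ ≤ 1 / (8 * (nE + 1) * (1520 * (nP * K ^ 2 + 1))) := min_le_right _ _
  refine ⟨ε₁, 1 / (9 * K ^ 2), hε₁pos, by positivity, fun V hclose hmin e₀ => ?_⟩
  -- charts on every link
  have hlink : ∀ e : Edge d S, ‖r.ρ (V e * (U₀ e)⁻¹) - 1‖ = ‖r.ρ (V e) - r.ρ (U₀ e)‖ := fun e => by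
    have h : r.ρ (V e * (U₀ e)⁻¹) - 1 = (r.ρ (V e) - r.ρ (U₀ e)) * r.ρ (U₀ e)⁻¹ := by
      rw [sub_mul, ← map_mul, hinv2]
    rw [h, Matrix.frobenius_norm_mul_unitaryGroup _ ⟨r.ρ (U₀ e)⁻¹, r.mem_unitary _⟩]
  have hXex : ∀ e : Edge d S, ∃ X : Matrix (Fin r.N) (Fin r.N) ℂ, X ∈ repLieAlgebra r ∧
      r.ρ (V e) = exp X * r.ρ (U₀ e) ∧ ‖X‖ ≤ 2 * ‖r.ρ (V e) - r.ρ (U₀ e)‖ := by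
    intro e
    have hlt : ‖r.ρ (V e * (U₀ e)⁻¹) - 1‖ < r₀ := by rw [hlink]; exact (hclose e).trans_lt hε₁r
    obtain ⟨X, hXt, hXe, hXn⟩ := hchart _ hlt
    refine ⟨X, ?_, ?_, by rwa [hlink] at hXn⟩
    · rw [mem_repLieAlgebra_iff]
      intro t
      obtain ⟨k, hk⟩ := hXt t
      exact ⟨k, by rw [hk]; rfl⟩
    · rw [hXe, map_mul, mul_assoc, hinv1, mul_one]
  choose X hX𝔤 hXV hXn using hXex
  -- norms of the coordinates
  set Nx2 : ℝ := ∑ e, ‖X e‖ ^ 2 with hNx2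
  have hNx2_0 : 0 ≤ Nx2 := Finset.sum_nonneg fun e _ => sq_nonneg _
  set Nx : ℝ := Real.sqrt Nx2 with hNx
  have hNx0 : 0 ≤ Nx := Real.sqrt_nonneg _
  have hNxsq : Nx ^ 2 = Nx2 := Real.sq_sqrt hNx2_0
  have hXle : ∀ e, ‖X e‖ ≤ Nx := fun e => by
    rw [hNx, ← Real.sqrt_sq (norm_nonneg (X e))]
    exact Real.sqrt_le_sqrt (Finset.single_le_sum (fun e _ => sq_nonneg (‖X e‖)) (Finset.mem_univ e))
  have hXε : ∀ e, ‖X e‖ ≤ 2 * ε₁ := fun e => (hXn e).trans (by linarith [hclose e])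
  have hNx2le : Nx2 ≤ nE * (2 * ε₁) ^ 2 := by
    calc Nx2 = ∑ e, ‖X e‖ ^ 2 := rfl
      _ ≤ ∑ _e : Edge d S, (2 * ε₁) ^ 2 := Finset.sum_le_sum fun e _ =>
          pow_le_pow_left₀ (norm_nonneg _) (hXε e) 2
      _ = nE * (2 * ε₁) ^ 2 := by rw [Finset.sum_const, Finset.card_univ, nsmul_eq_mul, hnE]
  -- `Nx ≤ 2 ε₁ (nE + 1) ≤ 1/(4M)`, `M = 1520 (nP K² + 1)`, hence the smallness conditions
  have hNxle : Nx ≤ 2 * ε₁ * (nE + 1) := by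
    have h1 : Nx ^ 2 ≤ (2 * ε₁ * (nE + 1)) ^ 2 := by
      rw [hNxsq]
      refine hNx2le.trans ?_
      have : nE ≤ (nE + 1) ^ 2 := by nlinarith
      nlinarith [sq_nonneg (2 * ε₁)]
    exact (pow_le_pow_iff_left₀ hNx0 (mul_nonneg (mul_nonneg two_pos.le hε₁pos.le) (by linarith)) two_ne_zero).1 h1
  set M : ℝ := 1520 * (nP * K ^ 2 + 1) with hM
  have hM1 : 1 ≤ M := by rw [hM]; nlinarith [sq_nonneg K, mul_nonneg hnP0 (sq_nonneg K)]
  have hM0 : 0 < M := by linarith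
  have hNxM : Nx ≤ 1 / (4 * M) := by
    refine hNxle.trans ?_
    have h2 : 2 * ε₁ * (nE + 1) ≤ 2 * (1 / (8 * (nE + 1) * M)) * (nE + 1) :=
      mul_le_mul_of_nonneg_right (mul_le_mul_of_nonneg_left hε₁b (by norm_num)) (by linarith)
    refine h2.trans (le_of_eq ?_)
    have hne : nE + 1 ≠ 0 := by linarith
    field_simp
    ring
  have h4M : 0 < 4 * M := by linarith
  have hNx4 : Nx ≤ 1 / 4 := hNxM.trans (by
    rw [div_le_div_iff₀ h4M four_pos]; linarith)
  have hNxs : Nx ≤ 1 / (1520 * (nP * K ^ 2 + 1)) := hNxM.trans (by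
    rw [← hM, div_le_div_iff₀ h4M hM0]; linarith)
  clear_value M ε₁
  have hXle4 : ∀ e, ‖X e‖ ≤ 1 / 4 := fun e => (hXle e).trans hNx4

  -- Hodge decomposition of `X`: `X = d₀η + rest`, `T = ‖d₀η‖`, `B = ‖rest‖`
  obtain ⟨η, T, B, hη𝔤, hT0, hB0, hpyth, htr, hDe, hB⟩ := hdata X hX𝔤
  set Dm : Edge d S → Matrix (Fin r.N) (Fin r.N) ℂ := fun e => η e.1 - r.ρ (U₀ e) * η (e.1.shift e.2) * r.ρ (U₀ e)⁻¹
    with hDm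
  -- the gauge directions as matrices: `P e = η x`, `Q e = −Ad_{U₀ e} η y`, `P + Q = (d₀ η) e`
  set Pm : Edge d S → Matrix (Fin r.N) (Fin r.N) ℂ := fun e => η e.1 with hPm
  set Qm : Edge d S → Matrix (Fin r.N) (Fin r.N) ℂ := fun e => -(r.ρ (U₀ e) * η (e.1.shift e.2) * r.ρ (U₀ e)⁻¹) with hQm
  have hPQ : ∀ e, Pm e + Qm e = Dm e := fun e => by simp only [hPm, hQm, hDm, sub_eq_add_neg]
  -- FIRST-ORDER CONDITION from gauge-minimality
  have hvar : ∑ e, (Matrix.trace ((exp (X e) - 1)ᴴ * (Pm e + Qm e))).re = 0 := by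
    refine sum_inner_eq_zero_of_isMinOn_exp_mul_exp (fun e => exp (X e)) Pm Qm fun t => ?_
    -- the competitor gauge transformation `h_t(x) = ρ⁻¹ exp(t η x)`
    have hkex : ∀ x : Site d S, ∃ k : G, r.ρ k = exp (t • η x) := fun x => by
      obtain ⟨k, hk⟩ := (mem_repLieAlgebra_iff r).1 (hη𝔤 x) t
      exact ⟨k, by rw [hk]; rfl⟩
    choose k hk using hkex
    have hL : ∀ e, ‖r.ρ (V e) - r.ρ (U₀ e)‖ = ‖exp (X e) - 1‖ := fun e => by
      have h : r.ρ (V e) - r.ρ (U₀ e) = (exp (X e) - 1) * r.ρ (U₀ e) := by rw [hXV, sub_mul, one_mul]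
      rw [h, Matrix.frobenius_norm_mul_unitaryGroup _ ⟨r.ρ (U₀ e), r.mem_unitary _⟩]
    have hR : ∀ e, ‖r.ρ (V e) - r.ρ (gaugeTransform k U₀ e)‖ = ‖exp (X e) - exp (t • Pm e) * exp (t • Qm e)‖ := fun e => by
      have hk' : r.ρ (k (e.1.shift e.2)) = exp (t • η (e.1.shift e.2)) * r.ρ 1 := by
        rw [map_one, mul_one]; exact hk _
      have hkinv := rho_inv_of_eq_exp_mul r hk'
      rw [inv_one, map_one, one_mul] at hkinv
      have hconj : r.ρ (U₀ e) * exp (-(t • η (e.1.shift e.2))) * r.ρ (U₀ e)⁻¹ =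
          exp (t • Qm e) := by
        rw [rho_mul_exp_mul_rho_inv, hQm]
        congr 1
        simp only [Matrix.mul_neg, Matrix.neg_mul, smul_neg, Matrix.mul_smul, Matrix.smul_mul]
      have h : r.ρ (V e) - r.ρ (gaugeTransform k U₀ e) = (exp (X e) - exp (t • Pm e) * exp (t • Qm e)) * r.ρ (U₀ e) := by
        simp only [gaugeTransform, map_mul, hXV, hkinv, hk, hPm]
        rw [← hconj, sub_mul]
        congr 1
        simp only [mul_assoc, hinv1, mul_one]
      rw [h, Matrix.frobenius_norm_mul_unitaryGroup _ ⟨r.ρ (U₀ e), r.mem_unitary _⟩]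
    have h := hmin k
    simp only [hL, hR] at h
    exact h

  -- rewrite it with the Frobenius inner product: `Σ ⟪exp X_e − 1, (d₀η)_e⟫ = 0`, `Σ ⟪X_e, (d₀η)_e⟫ = T²`
  have hvar' : ∑ e, ⟪exp (X e) - 1, Dm e⟫ = 0 := by
    rw [← hvar]
    exact Finset.sum_congr rfl fun e _ => by rw [hPQ]; rfl
  have hinnerX : ∑ e, ⟪X e, Dm e⟫ = T ^ 2 := by rw [← htr]; rfl
  -- `T² ≤ 2 Nx2 · T`, hence `T ≤ 2 Nx2`
  have hTle : T ^ 2 ≤ 2 * Nx2 * T := by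
    have hsum : ∑ e, ⟪X e, Dm e⟫ = -∑ e, ⟪exp (X e) - 1 - X e, Dm e⟫ := by
      rw [eq_neg_iff_add_eq_zero, ← Finset.sum_add_distrib, ← hvar']
      exact Finset.sum_congr rfl fun e _ => by rw [← inner_add_left, add_sub_cancel]
    have hbound : ∀ e, |⟪exp (X e) - 1 - X e, Dm e⟫| ≤ 2 * ‖X e‖ ^ 2 * T := by
      intro e
      refine (abs_real_inner_le_norm _ _).trans ?_
      have h1 : ‖exp (X e) - 1 - X e‖ ≤ 2 * ‖X e‖ ^ 2 :=
        ColdBoxAllGroups.norm_exp_sub_one_sub_le ((hXle4 e).trans (by norm_num))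
      exact mul_le_mul h1 (hDe e) (norm_nonneg _) (by positivity)
    rw [← hinnerX, hsum]
    calc -∑ e, ⟪exp (X e) - 1 - X e, Dm e⟫ ≤ ∑ e, |⟪exp (X e) - 1 - X e, Dm e⟫| := by
          rw [← Finset.sum_neg_distrib]
          exact Finset.sum_le_sum fun e _ => neg_le_abs _
      _ ≤ ∑ e, 2 * ‖X e‖ ^ 2 * T := Finset.sum_le_sum fun e _ => hbound e
      _ = 2 * Nx2 * T := by rw [hNx2, Finset.mul_sum, Finset.sum_mul]
  have hT2 : T ≤ 2 * Nx2 := by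
    by_cases hT00 : T = 0
    · rw [hT00]; linarith [hNx2_0]
    · have hTpos : 0 < T := lt_of_le_of_ne hT0 (Ne.symm hT00)
      have h1 : T * T ≤ 2 * Nx2 * T := by rw [← pow_two]; exact hTle
      exact le_of_mul_le_mul_right h1 hTpos
  -- per-plaquette cost bound `½‖(d₁X)_p‖² ≤ cost_p + 190 Nx³` and the curvature bound `B² ≤ K² (2 S + 380 nP Nx Nx2)`
  set cost : Plaquette d S → ℝ := fun p => (r.N : ℝ) - (r.ρ ((if p.2 = q ∧ p.1 q.1.1 = 0 ∧ p.1 q.1.2 = 0 then z else 1) *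
      plaquetteHolonomy V p.1 p.2.1.1 p.2.1.2)).trace.re with hcost
  have hcostp : ∀ p : Plaquette d S,
      ‖X (p.1, p.2.1.1) + r.ρ (U₀ (p.1, p.2.1.1)) * X (p.1.shift p.2.1.1, p.2.1.2) * r.ρ (U₀ (p.1, p.2.1.1))⁻¹ -
          r.ρ (U₀ (p.1, p.2.1.2)) * X (p.1.shift p.2.1.2, p.2.1.1) * r.ρ (U₀ (p.1, p.2.1.2))⁻¹ - X (p.1, p.2.1.2)‖ ^ 2 ≤
        2 * cost p + 380 * Nx ^ 3 := by
    intro p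
    set t : G := (if p.2 = q ∧ p.1 q.1.1 = 0 ∧ p.1 q.1.2 = 0 then z else 1) with ht
    have htc : t ∈ Subgroup.center G := by rw [ht]; split_ifs; exacts [hz, one_mem _]
    have h := abs_le.1 (abs_twistedCost_sub_half_norm_sq_le r U₀ V p.1 p.2.1.1 p.2.1.2 htc (htf p) X hX𝔤 hXV hNx4 hXle)
    have hc : cost p = (r.N : ℝ) - (r.ρ (t * plaquetteHolonomy V p.1 p.2.1.1 p.2.1.2)).trace.re := by rw [hcost]
    linarith [h.1]
  have hBK : B ^ 2 ≤ K ^ 2 * (2 * (∑ p, cost p) + 380 * nP * Nx * Nx2) := by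
    refine hB.trans (mul_le_mul_of_nonneg_left ?_ (sq_nonneg K))
    calc _ ≤ ∑ p, (2 * cost p + 380 * Nx ^ 3) := Finset.sum_le_sum fun p _ => hcostp p
      _ = 2 * ∑ p, cost p + nP * (380 * Nx ^ 3) := by
          rw [Finset.sum_add_distrib, Finset.mul_sum, Finset.sum_const, Finset.card_univ, nsmul_eq_mul, hnP]
      _ = 2 * (∑ p, cost p) + 380 * nP * Nx * Nx2 := by rw [← hNxsq]; ring
  -- the absorption
  have hmain : Nx2 ≤ 4 * K ^ 2 * ∑ p, cost p := absorb_aux hK hNx2_0 hnP0 hNx0 hNxsq hNx4 hNxs hpyth hT0 hT2 hBK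
  -- the link `e₀`
  have hlink0 : ‖r.ρ (V e₀) - r.ρ (U₀ e₀)‖ ^ 2 ≤ 9 / 4 * Nx2 := by
    have h1 : ‖r.ρ (V e₀) - r.ρ (U₀ e₀)‖ = ‖exp (X e₀) - 1‖ := by
      have h : r.ρ (V e₀) - r.ρ (U₀ e₀) = (exp (X e₀) - 1) * r.ρ (U₀ e₀) := by rw [hXV, sub_mul, one_mul]
      rw [h, Matrix.frobenius_norm_mul_unitaryGroup _ ⟨r.ρ (U₀ e₀), r.mem_unitary _⟩]
    have h2 : ‖exp (X e₀) - 1‖ ≤ 3 / 2 * ‖X e₀‖ := ColdBoxAllGroups.norm_exp_sub_one_le' (hXle4 e₀)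
    have h3 : ‖X e₀‖ ^ 2 ≤ Nx2 := by
      rw [hNx2]; exact Finset.single_le_sum (fun e _ => sq_nonneg (‖X e‖)) (Finset.mem_univ e₀)
    rw [h1]
    calc ‖exp (X e₀) - 1‖ ^ 2 ≤ (3 / 2 * ‖X e₀‖) ^ 2 := pow_le_pow_left₀ (norm_nonneg _) h2 2
      _ = 9 / 4 * ‖X e₀‖ ^ 2 := by ring
      _ ≤ 9 / 4 * Nx2 := by linarith [h3]
  have hK2 : 0 < 9 * K ^ 2 := by positivity
  rw [show (∑ p : Plaquette d S, ((r.N : ℝ) - (r.ρ ((if p.2 = q ∧ p.1 q.1.1 = 0 ∧ p.1 q.1.2 = 0 then z else 1) *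
      plaquetteHolonomy V p.1 p.2.1.1 p.2.1.2)).trace.re)) = ∑ p, cost p from rfl, one_div, inv_mul_le_iff₀ hK2]
  exact hlink0.trans ((mul_le_mul_of_nonneg_left hmain (by norm_num)).trans_eq (by ring))

end Summit.QuantumFields.YangMills.Theorems.TwistExponentGap

end
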